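import Literature.NumberTheory.EllipticCurves.Curve8x121SharpDescentY
import Literature.NumberTheory.EllipticCurves.IsogenyTwoTorsionProofs
import Literature.NumberTheory.EllipticCurves.IsogenyVariableChangeProofs
import Literature.NumberTheory.EllipticCurves.IsogenyCompProofs
import Literature.NumberTheory.EllipticCurves.IsogenyMordellWeilRankProofs
import Literature.NumberTheory.EllipticCurves.SelmerCorankIsogenyProofs
import Literature.NumberTheory.EllipticCurves.IwasawaLeadingTermProofs
import HarnessLib

/-!
# `X = [0, 8, 0, 121, 0]` has `rank X(ℚ) = 1` and `t_2(X) = corank_{ℤ₂} Ш(X/ℚ)[2^∞] = 0` THROUGH THE ISOGENY CLASS: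
# `X ~ Y` with the sharp descent of `Curve8x121SharpDescentY` (rank and `t_p` are isogeny invariants)

Topic `NumberTheory/EllipticCurves`. Second file of the rank-`1` isogeny-door cell. `X' = X.twoIsogenyCodomain = [0, -16, 0, -420, 0]`
has full rational `2`-torsion and `Y = ⟨1, -14, 0, 0⟩ • X' = [0, -58, 0, 616, 0]`; so `X ~ Y` over `ℚ` (tree:
`isIsogenous_twoIsogenyCodomain`, `isIsogenous_of_smul_eq`, `IsIsogenous.trans'`), and the sharp descent on `Y` (`rank Y(ℚ) = 1`,
`t_2(Y) = 0`) gives **`rank X(ℚ) = 1`** and **`t_2(X) = 0`** (`IsIsogenous.mordellWeilRank_eq`, `IsIsogenous.shaCorank_eq`) and the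
finiteness of `Ш(X/ℚ)[2^∞]` — although the descent via `X → X'` itself does not close (`Curve8x121NontrivialSha`: `Ш(X/ℚ)[2] ≠ 0`).
Theorems only; no definitions, no named facts.

## References

* [SilvermanAEC2009] J. H. Silverman, *AEC*, 2nd ed.: III.4.5, III.6, Prop. X.4.9.
* [Greenberg1999LNM] R. Greenberg, LNM 1716, §1 pp. 54–57; [MilneADT2006] J. S. Milne, *ADT*, I.7.
-/

noncomputable section

open scoped Classical

namespace Literature.NumberTheory.EllipticCurves

namespace Curve8x121

open _root_.WeierstrassCurve _root_.WeierstrassCurve.Affine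

/-! ## 1. The curves `X`, `X'` -/

/-- `b(a² − 4b) ≠ 0` for `X = E_{8,121}`. [cite: SilvermanAEC2009, Prop. X.4.9] -/
theorem habX : (121 : ℤ) * ((8 : ℤ) ^ 2 - 4 * 121) ≠ 0 := by norm_num

/-- The tree's literal `E_{a,b}` for `(a,b) = (8,121)` is `X`. [cite: SilvermanAEC2009, Prop. X.4.9] -/
theorem lit_X : (⟨0, ((8 : ℤ) : ℚ), 0, ((121 : ℤ) : ℚ), 0⟩ : WeierstrassCurve ℚ) = ⟨0, 8, 0, 121, 0⟩ := by
  ext <;> push_cast <;> ring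

/-- The tree's literal `E_{−2a, a²−4b}` for `(a,b) = (8,121)` is `X' = [0, -16, 0, -420, 0]`. [cite: SilvermanAEC2009, Prop. X.4.9] -/
theorem lit_X' :
    (⟨0, ((-2 * (8) : ℤ) : ℚ), 0, (((8 : ℤ) ^ 2 - 4 * 121 : ℤ) : ℚ), 0⟩ : WeierstrassCurve ℚ) = ⟨0, -16, 0, -420, 0⟩ := by
  ext <;> push_cast <;> ring

/-- `X = [0, 8, 0, 121, 0]` is an elliptic curve. [cite: SilvermanAEC2009, Prop. X.4.9] -/
theorem isElliptic_X : (⟨0, 8, 0, 121, 0⟩ : WeierstrassCurve ℚ).IsElliptic := by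
  rw [← lit_X]; exact isElliptic_mk_of_ne_zero (F := ℚ) habX

/-- `X' = [0, -16, 0, -420, 0]` is an elliptic curve. [cite: SilvermanAEC2009, Prop. X.4.9] -/
theorem isElliptic_X' : (⟨0, -16, 0, -420, 0⟩ : WeierstrassCurve ℚ).IsElliptic := by
  rw [← lit_X']; exact isElliptic_mk_of_ne_zero (F := ℚ) (twoIsogenyCodomain_ne_zero habX)

/-! ## 2. `X ~ Y`: `rank X(ℚ) = 1` and `t_2(X) = 0` -/

/-- `X' = X.twoIsogenyCodomain = [0, -16, 0, -420, 0]`. [cite: SilvermanAEC2009, III.4.5 (the explicit 2-isogeny)] -/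
theorem twoIsogenyCodomain_X :
    (⟨0, 8, 0, 121, 0⟩ : WeierstrassCurve ℚ).twoIsogenyCodomain = ⟨0, -16, 0, -420, 0⟩ := by
  rw [← lit_X, twoIsogenyCodomain_mk_intCast, lit_X']

/-- `Y = ⟨1, -14, 0, 0⟩ • X'`. [cite: SilvermanAEC2009, III.3.1(b)] -/
theorem smul_X'_eq_Y :
    (⟨1, -14, 0, 0⟩ : VariableChange ℚ) • (⟨0, -16, 0, -420, 0⟩ : WeierstrassCurve ℚ) =
      ⟨0, -58, 0, 616, 0⟩ := by
  ext
  · simp [WeierstrassCurve.variableChange_a₁]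
  · rw [WeierstrassCurve.variableChange_a₂]; norm_num
  · simp [WeierstrassCurve.variableChange_a₃]
  · rw [WeierstrassCurve.variableChange_a₄]; norm_num
  · rw [WeierstrassCurve.variableChange_a₆]; norm_num

/-- **`X ~ Y` over `ℚ`** (the `2`-isogeny `X → X'` followed by the isomorphism `X' ≅ Y`). [cite: SilvermanAEC2009, III.4.5 and III.6] -/
theorem isIsogenous_X_Y :
    IsIsogenous (⟨0, 8, 0, 121, 0⟩ : WeierstrassCurve ℚ) (⟨0, -58, 0, 616, 0⟩ : WeierstrassCurve ℚ) := by
  haveI := isElliptic_X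
  have h1 : IsIsogenous (⟨0, 8, 0, 121, 0⟩ : WeierstrassCurve ℚ) (⟨0, -16, 0, -420, 0⟩ : WeierstrassCurve ℚ) :=
    isIsogenous_of_eq_twoIsogenyCodomain _ twoIsogenyCodomain_X
  exact h1.trans' (isIsogenous_of_smul_eq smul_X'_eq_Y)

/-- **`rank X(ℚ) = 1`** (rank is an isogeny invariant; `rank Y(ℚ) = 1`). [cite: MilneADT2006, proof of Thm. I.7.3 (p. 97)] -/
theorem mordellWeilRank_X : (⟨0, 8, 0, 121, 0⟩ : WeierstrassCurve ℚ).mordellWeilRank = 1 := by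
  haveI := isElliptic_X
  haveI := isElliptic_Y
  rw [isIsogenous_X_Y.mordellWeilRank_eq, mordellWeilRank_Y]

/-- **`t_2(X) = corank_{ℤ₂} Ш(X/ℚ)[2^∞] = 0`** (`t_p` is an isogeny invariant; `t_2(Y) = 0`). [cite: Greenberg1999LNM, §1 pp. 54–57] -/
theorem shaCorank_X_two : (⟨0, 8, 0, 121, 0⟩ : WeierstrassCurve ℚ).shaCorank 2 = 0 := by
  haveI := isElliptic_X
  haveI := isElliptic_Y
  haveI : Fact (Nat.Prime 2) := ⟨Nat.prime_two⟩
  rw [isIsogenous_X_Y.shaCorank_eq 2, shaCorank_Y_two]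

/-- **`Ш(X/ℚ)[2^∞]` is finite.** [cite: Greenberg1999LNM, §1 pp. 54–57] -/
theorem finite_primaryComponent_sha_X_two :
    Finite (AddCommGroup.primaryComponent (⟨0, 8, 0, 121, 0⟩ : WeierstrassCurve ℚ).sha 2) := by
  haveI := isElliptic_X
  haveI : Fact (Nat.Prime 2) := ⟨Nat.prime_two⟩
  exact (finite_primaryComponent_sha_iff_shaCorank_eq_zero _ 2).mpr shaCorank_X_two


end Curve8x121

end Literature.NumberTheory.EllipticCurves

end
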